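import Mathlib
import HarnessLib
import Literature.Analysis.FluidPDE.VectorCalculus
import Summits.NavierStokesRegularity.NavierStokesRegularity.Theorems.UnthreadedRigidityDoorUnthreadedRigidityVirialHornAngularFrame

/-!
# Route `UnthreadedRigidityDoor`, item `UnthreadedRigidity` (W2, stmt-NavierStokesRegularity-27585) — LINE g11-1 «VIRIAL HORN»:
# the KEY POINTWISE IDENTITY behind the ANGULAR LEMMA S-C in every degree

Prover file (engine-1 g71, free prover hand; `--supports stmt-NavierStokesRegularity-27585 --as helper`) for LINE g11-1 «VIRIAL HORN»
of planner ns-idea-6 g11 (objects BY NAME in `Theorems/UnthreadedRigidityDoorUnthreadedRigidityVirialHornDefs.lean`, p695782; frame algebra in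
`…VirialHornAngularFrame.lean`).

At a point `y` with `R = y × g ≠ 0` (`g = ∇Y(y)`, `S = Hess Y(y)`, `T = D Hess Y(y)`), the jet relations of a solid harmonic whose angular form
`{Y,|∇Y|²} = 2⟪R, S g⟫` vanishes identically — symmetry of `S`, `T`; Euler `⟪y,g⟫ = lY`, `S y = (l−1) g`, `T y = (l−2) S`; `tr S = 0`,
`tr T(w) = 0`; `⟪R, S g⟫ = 0` and its first derivatives `⟪w × g + y × S w, S g⟫ + ⟪R, T w g + S (S w)⟫ = 0` — give, in this order:
`S R = −cR` (`c‖R‖² = −⟪SR,R⟫`); `⟪Sτ,τ⟫` from the trace (`τ = R × y`); `⟪T g g, R⟫ = 0` (derivative along `g`) hence `⟪T R R, R⟫ = 0`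
(trace of `T R` in the frame: THE LEVEL CURVES OF `Y|_{S²}` ARE CIRCLES); `⟪T R g, R⟫` (derivative along `R`); and finally, for the AXIS FIELD
`A = g + c y` with derivative `A′v = S v + (dc·v) y + c v` (`dc` in the raw quotient-rule form the calculus produces), `A′v × A = 0` for every `v`
(`cross_axisDeriv_axis_eq_zero`) — the `τ`-component being the Riccati law `∂_ν κ = 1 + κ²` of parallel circles, checked as the pure-ℝ identity
`angular_scalar_identity`.  The calculus layer (`…VirialHornAngularLemma.lean`) turns this into `AngularLemma`.

HONEST LABEL: linear algebra in `ℝ³` about SPECIAL separable data (support S-C of a RUNG line); `UnthreadedRigidity` (27585), W2 and NS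
regularity remain OPEN; nothing here is a statement about the Navier–Stokes equations.  0 kit.
-/

-- the summit and its single sub-problem share the name (CONVENTIONS §1), as in every Theorems file
set_option linter.dupNamespace false

namespace Summit.NavierStokesRegularity.NavierStokesRegularity.Theorems.UnthreadedRigidity.VirialHorn

open scoped InnerProductSpace
open Literature.Analysis.FluidPDE (cross)
open Summit.NavierStokesRegularity.NavierStokesRegularity.Theorems.UnthreadedRigidity.ProfileHorn (E3)

/-! ## Private coordinate copies of generic cross-product facts (the public API is the frame file) -/

/-- a component of the cross product (private copy). -/
private theorem cross_apply_zero (u v : E3) : cross u v 0 = u 1 * v 2 - u 2 * v 1 := by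
  simp [cross, cross_apply]

/-- a component of the cross product (private copy). -/
private theorem cross_apply_one (u v : E3) : cross u v 1 = u 2 * v 0 - u 0 * v 2 := by
  simp [cross, cross_apply]

/-- a component of the cross product (private copy). -/
private theorem cross_apply_two (u v : E3) : cross u v 2 = u 0 * v 1 - u 1 * v 0 := by
  simp [cross, cross_apply]

/-- the inner product in coordinates (private copy). -/
private theorem real_inner_e3 (u v : E3) : ⟪u, v⟫_ℝ = u 0 * v 0 + u 1 * v 1 + u 2 * v 2 := by
  simp [PiLp.inner_apply, Fin.sum_univ_three, mul_comm]

/-- anticommutativity (private copy). -/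
private theorem cross_anticomm' (u v : E3) : cross v u = -cross u v := by
  ext i
  fin_cases i <;> simp [cross_apply_zero, cross_apply_one, cross_apply_two] <;> ring

/-- `u × u = 0` (private copy). -/
private theorem cross_self' (u : E3) : cross u u = 0 := by
  ext i
  fin_cases i <;> simp [cross_apply_zero, cross_apply_one, cross_apply_two] <;> ring

/-- homogeneity in the second slot (private copy). -/
private theorem cross_smul_right' (c : ℝ) (u v : E3) : cross u (c • v) = c • cross u v := by
  ext i
  fin_cases i <;> simp [cross_apply_zero, cross_apply_one, cross_apply_two] <;> ring

/-- `(u × v) × w = ⟪u,w⟫ v − ⟪v,w⟫ u` (private copy). -/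
private theorem cross_cross_eq_left (u v w : E3) : cross (cross u v) w = ⟪u, w⟫_ℝ • v - ⟪v, w⟫_ℝ • u := by
  ext i
  fin_cases i <;> simp [cross_apply_zero, cross_apply_one, cross_apply_two, real_inner_e3] <;> ring

/-- `⟪u × v, u⟫ = 0` (private copy). -/
private theorem inner_cross_self_fst (u v : E3) : ⟪cross u v, u⟫_ℝ = 0 := by
  rw [real_inner_e3, cross_apply_zero, cross_apply_one, cross_apply_two]; ring

/-- `⟪u × v, v⟫ = 0` (private copy). -/
private theorem inner_cross_self_snd (u v : E3) : ⟪cross u v, v⟫_ℝ = 0 := by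
  rw [real_inner_e3, cross_apply_zero, cross_apply_one, cross_apply_two]; ring

/-- Lagrange's identity in inner-product form (private copy). -/
private theorem inner_cross_self_eq (u v : E3) :
    ⟪cross u v, cross u v⟫_ℝ = ⟪u, u⟫_ℝ * ⟪v, v⟫_ℝ - ⟪u, v⟫_ℝ ^ 2 := by
  simp only [real_inner_e3, cross_apply_zero, cross_apply_one, cross_apply_two]; ring

/-- pure-ℝ core of the transversal (Riccati) step. -/
theorem angular_scalar_identity
    (l Y0 r2 ρ a p q σ G t₁ sττ w3v sτv dcv c vg : ℝ) (hr2 : r2 ≠ 0) (hρ : ρ ≠ 0)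
    (hc : c * ρ = -a)
    (hdc : dcv * ρ = -w3v)
    (hw3 : r2 * ρ * w3v = ρ * (l - 2) * a * p + (r2 * t₁ - l * Y0 * (l - 2) * a) * q)
    (hsτv : r2 * ρ * sτv = ρ ^ 2 * (l - 1) * p + sττ * q)
    (hsττ : sττ = -ρ * (l - 1) * l * Y0 - r2 * a)
    (ht1 : ρ * t₁ = -ρ * (l * Y0 * σ - (l - 1) * G ^ 2) - 2 * a ^ 2)
    (hσ : r2 ^ 2 * σ = sττ + 2 * (l * Y0) * ((l - 1) * ρ) + (l * Y0) ^ 2 * ((l - 1) * l * Y0))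
    (hG : r2 * G = ρ + (l * Y0) ^ 2)
    (hvg : r2 * vg = q + l * Y0 * p) :
    ((l - 1) * vg + dcv * r2 + c * p) * ρ = (sτv + c * q) * (l * Y0 + c * r2) := by
  have hc' : c = -a / ρ := by rw [eq_div_iff hρ]; exact hc
  have hdc' : dcv = -w3v / ρ := by rw [eq_div_iff hρ]; exact hdc
  have hr2ρ : r2 * ρ ≠ 0 := mul_ne_zero hr2 hρ
  have hw3' : w3v = (ρ * (l - 2) * a * p + (r2 * t₁ - l * Y0 * (l - 2) * a) * q) / (r2 * ρ) := by
    rw [eq_div_iff hr2ρ]; linarith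
  have hsτv' : sτv = (ρ ^ 2 * (l - 1) * p + sττ * q) / (r2 * ρ) := by
    rw [eq_div_iff hr2ρ]; linarith
  have ht1' : t₁ = (-ρ * (l * Y0 * σ - (l - 1) * G ^ 2) - 2 * a ^ 2) / ρ := by
    rw [eq_div_iff hρ]; linarith
  have hσ' : σ = (sττ + 2 * (l * Y0) * ((l - 1) * ρ) + (l * Y0) ^ 2 * ((l - 1) * l * Y0)) / r2 ^ 2 := by
    rw [eq_div_iff (pow_ne_zero 2 hr2)]; linarith
  have hG' : G = (ρ + (l * Y0) ^ 2) / r2 := by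
    rw [eq_div_iff hr2]; linarith
  have hvg' : vg = (q + l * Y0 * p) / r2 := by
    rw [eq_div_iff hr2]; linarith
  rw [hdc', hw3', ht1', hσ', hG', hsτv', hvg', hsττ, hc']
  field_simp
  ring

/-! ## The pointwise KEY identity -/

/-- **KEY POINTWISE IDENTITY of the angular lemma.**  At a point `y` with `R = y × g ≠ 0`, the jet relations of a solid harmonic whose
angular form vanishes identically — symmetry of `S` and `T`, Euler (`⟪y,g⟫ = lY₀`, `S y = (l−1)g`, `T y = (l−2)S`), harmonicity
(`tr S = 0`, `tr T(w) = 0`), the angular form itself (`⟪y × g, S g⟫ = 0`) and its first derivatives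
(`⟪w × g + y × S w, S g⟫ + ⟪y × g, T w g + S(S w)⟫ = 0`) — force `A′v × A = 0` for the axis field `A = g + c y`,
`c ‖R‖² = −⟪S R, R⟫`, and its derivative `A′v = S v + (dc·v) y + c v` (`dc` by the quotient rule, as the calculus produces it). -/
theorem cross_axisDeriv_axis_eq_zero
    (l Y0 c dc : ℝ) (y g v : E3) (S : E3 →L[ℝ] E3) (T : E3 →L[ℝ] E3 →L[ℝ] E3)
    (hS : ∀ u w, ⟪S u, w⟫_ℝ = ⟪u, S w⟫_ℝ)
    (hT1 : ∀ u w, T u w = T w u)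
    (hT2 : ∀ u w z, ⟪T u w, z⟫_ℝ = ⟪T u z, w⟫_ℝ)
    (hE0 : ⟪y, g⟫_ℝ = l * Y0)
    (hE1 : S y = (l - 1) • g)
    (hE2 : ∀ w, T y w = (l - 2) • S w)
    (htr : ∑ i : Fin 3, ⟪S (e i), e i⟫_ℝ = 0)
    (htrT : ∀ w, ∑ i : Fin 3, ⟪T w (e i), e i⟫_ℝ = 0)
    (hH : ⟪cross y g, S g⟫_ℝ = 0)
    (hdH : ∀ w, ⟪cross w g + cross y (S w), S g⟫_ℝ + ⟪cross y g, T w g + S (S w)⟫_ℝ = 0)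
    (hR : cross y g ≠ 0)
    (hc : c * ⟪cross y g, cross y g⟫_ℝ = -⟪S (cross y g), cross y g⟫_ℝ)
    (hdc : dc * ⟪cross y g, cross y g⟫_ℝ ^ 2 =
      -((⟪T v (cross y g) + S (cross v g + cross y (S v)), cross y g⟫_ℝ
          + ⟪S (cross y g), cross v g + cross y (S v)⟫_ℝ) * ⟪cross y g, cross y g⟫_ℝ
        - ⟪S (cross y g), cross y g⟫_ℝ
          * (⟪cross v g + cross y (S v), cross y g⟫_ℝ + ⟪cross y g, cross v g + cross y (S v)⟫_ℝ))) :
    cross (S v + dc • y + c • v) (g + c • y) = 0 := by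
  -- names: `R = y × g`, `τ = R × y`; scalars `ρ = ‖R‖²`, `a = ⟪S R, R⟫`, `r2 = ‖y‖²`, `G = ‖g‖²`
  set R := cross y g with hRdef
  set τ := cross R y with hτdef
  have hρ : 0 < ⟪R, R⟫_ℝ := real_inner_self_pos.mpr hR
  have hρ0 : ⟪R, R⟫_ℝ ≠ 0 := hρ.ne'
  have hy : y ≠ 0 := by
    rintro rfl
    apply hR
    ext i
    fin_cases i <;> simp [hRdef, cross_apply_zero, cross_apply_one, cross_apply_two]
  have hr2 : 0 < ⟪y, y⟫_ℝ := real_inner_self_pos.mpr hy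
  have hr20 : ⟪y, y⟫_ℝ ≠ 0 := hr2.ne'
  -- exact orthogonality of the frame (both orientations)
  have hRy : ⟪R, y⟫_ℝ = 0 := inner_cross_self_fst y g
  have hyR : ⟪y, R⟫_ℝ = 0 := by rw [real_inner_comm R y]; exact hRy
  have hRg : ⟪R, g⟫_ℝ = 0 := inner_cross_self_snd y g
  have hgR : ⟪g, R⟫_ℝ = 0 := by rw [real_inner_comm R g]; exact hRg
  have hτy : ⟪τ, y⟫_ℝ = 0 := inner_cross_self_snd R y
  have hyτ : ⟪y, τ⟫_ℝ = 0 := by rw [real_inner_comm τ y]; exact hτy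
  have hτR : ⟪τ, R⟫_ℝ = 0 := inner_cross_self_fst R y
  have hRτ : ⟪R, τ⟫_ℝ = 0 := by rw [real_inner_comm τ R]; exact hτR
  have hτg : ⟪τ, g⟫_ℝ = ⟪R, R⟫_ℝ := inner_tau_g y g
  have hgτ : ⟪g, τ⟫_ℝ = ⟪R, R⟫_ℝ := by rw [real_inner_comm τ g]; exact hτg
  have hττ : ⟪τ, τ⟫_ℝ = ⟪y, y⟫_ℝ * ⟪R, R⟫_ℝ := inner_tau_tau y g
  have hgy : ⟪g, y⟫_ℝ = l * Y0 := by rw [real_inner_comm y g]; exact hE0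
  have hτeq : τ = ⟪y, y⟫_ℝ • g - (l * Y0) • y := by rw [hτdef, hRdef, frame_tau_eq, hE0]
  have hgeq : ⟪y, y⟫_ℝ • g = τ + (l * Y0) • y := by rw [hτeq]; abel
  have hGρ : ⟪y, y⟫_ℝ * ⟪g, g⟫_ℝ = ⟪R, R⟫_ℝ + (l * Y0) ^ 2 := by
    rw [hRdef, inner_cross_self_eq, hE0]; ring
  -- second-order facts
  have hSyy : ⟪S y, y⟫_ℝ = (l - 1) * l * Y0 := by rw [hE1, real_inner_smul_left, hgy]; ring
  have hSyg : ⟪S y, g⟫_ℝ = (l - 1) * ⟪g, g⟫_ℝ := by rw [hE1, real_inner_smul_left]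
  have hSyτ : ⟪S y, τ⟫_ℝ = (l - 1) * ⟪R, R⟫_ℝ := by rw [hE1, real_inner_smul_left, hgτ]
  have hSRy : ⟪S R, y⟫_ℝ = 0 := by rw [hS, hE1, real_inner_smul_right, hRg, mul_zero]
  have hSRg : ⟪S R, g⟫_ℝ = 0 := by rw [hS]; exact hH
  -- the rotation field is a Hessian eigenvector: `ρ • S R = a • R`
  have heig : ⟪R, R⟫_ℝ • S R = ⟪S R, R⟫_ℝ • R := by
    have h := frame_eigen_identity y g (S R)
    rw [← hRdef, hSRg, hSRy, zero_smul, zero_smul, sub_zero, sub_eq_zero] at h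
    exact h
  have hSR : ∀ w, ⟪R, R⟫_ℝ * ⟪S R, w⟫_ℝ = ⟪S R, R⟫_ℝ * ⟪R, w⟫_ℝ := fun w => by
    have := congrArg (fun z => ⟪z, w⟫_ℝ) heig
    simpa only [real_inner_smul_left] using this
  have hSRτ : ⟪S R, τ⟫_ℝ = 0 := by
    have := hSR τ
    rw [hRτ, mul_zero] at this
    exact (mul_eq_zero.mp this).resolve_left hρ0
  have hSRSR : ⟪R, R⟫_ℝ * ⟪S R, S R⟫_ℝ = ⟪S R, R⟫_ℝ * ⟪S R, R⟫_ℝ := by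
    rw [hSR (S R), ← hS R R]
  have hSτy : ⟪S τ, y⟫_ℝ = (l - 1) * ⟪R, R⟫_ℝ := by rw [hS, hE1, real_inner_smul_right, hτg]
  have hSτR : ⟪S τ, R⟫_ℝ = 0 := by rw [hS, real_inner_comm (S R) τ, hSRτ]
  -- harmonicity read in the frame
  have hsττ : ⟪S τ, τ⟫_ℝ = -⟪R, R⟫_ℝ * (l - 1) * l * Y0 - ⟪y, y⟫_ℝ * ⟪S R, R⟫_ℝ := by
    have h := frame_trace y g S
    rw [htr, mul_zero, ← hRdef, ← hτdef, hSyy] at h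
    linarith
  -- `S τ` resolved in the frame
  have hSτ : ∀ w, ⟪y, y⟫_ℝ * ⟪R, R⟫_ℝ * ⟪S τ, w⟫_ℝ =
      ⟪R, R⟫_ℝ ^ 2 * (l - 1) * ⟪y, w⟫_ℝ + ⟪S τ, τ⟫_ℝ * ⟪τ, w⟫_ℝ := fun w => by
    have h := frame_resolution y g (S τ)
    rw [← hRdef, ← hτdef, hSτy, hSτR, mul_zero, zero_smul, add_zero] at h
    have := congrArg (fun z => ⟪z, w⟫_ℝ) h
    simp only [real_inner_smul_left, inner_add_left] at this
    linarith [this]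
  have hSτg : ⟪S τ, g⟫_ℝ = -⟪S R, R⟫_ℝ := by
    have h := hSτ g
    rw [hE0, hτg, hsττ] at h
    have : ⟪y, y⟫_ℝ * ⟪R, R⟫_ℝ * ⟪S τ, g⟫_ℝ = ⟪y, y⟫_ℝ * ⟪R, R⟫_ℝ * (-⟪S R, R⟫_ℝ) := by
      linear_combination h
    exact mul_left_cancel₀ (mul_ne_zero hr20 hρ0) this
  have hτSg : ⟪τ, S g⟫_ℝ = -⟪S R, R⟫_ℝ := by rw [← hS]; exact hSτg
  have hσ : ⟪y, y⟫_ℝ ^ 2 * ⟪S g, g⟫_ℝ =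
      ⟪S τ, τ⟫_ℝ + 2 * (l * Y0) * ((l - 1) * ⟪R, R⟫_ℝ) + (l * Y0) ^ 2 * ((l - 1) * l * Y0) := by
    have e1 : ⟪S (⟪y, y⟫_ℝ • g), ⟪y, y⟫_ℝ • g⟫_ℝ = ⟪y, y⟫_ℝ ^ 2 * ⟪S g, g⟫_ℝ := by
      rw [map_smul, real_inner_smul_left, real_inner_smul_right]; ring
    have e2 : ⟪S (τ + (l * Y0) • y), τ + (l * Y0) • y⟫_ℝ =
        ⟪S τ, τ⟫_ℝ + 2 * (l * Y0) * ((l - 1) * ⟪R, R⟫_ℝ) + (l * Y0) ^ 2 * ((l - 1) * l * Y0) := by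
      rw [map_add, map_smul, inner_add_left, inner_add_right, inner_add_right, real_inner_smul_left,
        real_inner_smul_left, real_inner_smul_right, real_inner_smul_right, hSτy, hSyτ, hSyy]
      ring
    rw [← e1, hgeq, e2]
  -- third-order facts
  have hTRyw : ∀ w, ⟪T R y, w⟫_ℝ = (l - 2) * ⟪S R, w⟫_ℝ := fun w => by
    rw [hT1, hE2, real_inner_smul_left]
  have hTggR : ⟪T g g, R⟫_ℝ = 0 := by
    have h := hdH g
    rw [cross_self', zero_add, inner_cross_self_snd, zero_add, inner_add_right] at h
    have h2 : ⟪R, S (S g)⟫_ℝ = 0 := by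
      rw [← hS]
      have := hSR (S g)
      rw [hH, mul_zero] at this
      exact (mul_eq_zero.mp this).resolve_left hρ0
    rw [h2, add_zero] at h
    rw [real_inner_comm R (T g g)]
    exact h
  have hTRgg : ⟪T R g, g⟫_ℝ = 0 := by rw [hT1, hT2, hTggR]
  have hTRgy : ⟪T R g, y⟫_ℝ = 0 := by rw [hT2, hTRyw, hSRg, mul_zero]
  have hTRgτ : ⟪T R g, τ⟫_ℝ = 0 := by
    rw [hτeq, inner_sub_right, real_inner_smul_right, real_inner_smul_right, hTRgg, hTRgy]; ring
  have hTRRR : ⟪T R R, R⟫_ℝ = 0 := by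
    have h := frame_trace y g (T R)
    rw [htrT R, mul_zero, ← hRdef, ← hτdef] at h
    have h1 : ⟪T R y, y⟫_ℝ = 0 := by rw [hTRyw, hSRy, mul_zero]
    have h2 : ⟪T R τ, τ⟫_ℝ = 0 := by
      have e1 : T R τ = ⟪y, y⟫_ℝ • T R g - (l * Y0) • T R y := by rw [hτeq, map_sub, map_smul, map_smul]
      rw [e1, inner_sub_left, real_inner_smul_left, real_inner_smul_left, hTRyw, hSRτ, hTRgτ]; ring
    rw [h1, h2] at h
    have : ⟪y, y⟫_ℝ * ⟪T R R, R⟫_ℝ = 0 := by linarith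
    exact (mul_eq_zero.mp this).resolve_left hr20
  -- `t₁ = ⟪T R g, R⟫` from the derivative of the angular form along `R`
  have ht1 : ⟪R, R⟫_ℝ * ⟪T R g, R⟫_ℝ =
      -⟪R, R⟫_ℝ * (l * Y0 * ⟪S g, g⟫_ℝ - (l - 1) * ⟪g, g⟫_ℝ ^ 2) - 2 * ⟪S R, R⟫_ℝ ^ 2 := by
    have h := hdH R
    rw [inner_add_left, inner_add_right, real_inner_comm (T R g) R] at h
    have e1 : cross R g = (l * Y0) • g - ⟪g, g⟫_ℝ • y := by
      rw [hRdef, cross_cross_eq_left, hE0]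
    have e4 : ⟪cross R g, S g⟫_ℝ = l * Y0 * ⟪S g, g⟫_ℝ - (l - 1) * ⟪g, g⟫_ℝ ^ 2 := by
      rw [e1, inner_sub_left, real_inner_smul_left, real_inner_smul_left, real_inner_comm (S g) g, ← hS y g, hSyg]
      ring
    have e2 : ⟪R, R⟫_ℝ • cross y (S R) = -(⟪S R, R⟫_ℝ • τ) := by
      rw [← cross_smul_right', heig, cross_smul_right', cross_anticomm' R y]
      simp [hτdef]
    have e3 : ⟪R, R⟫_ℝ * ⟪cross y (S R), S g⟫_ℝ = ⟪S R, R⟫_ℝ * ⟪S R, R⟫_ℝ := by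
      have := congrArg (fun z => ⟪z, S g⟫_ℝ) e2
      simp only [real_inner_smul_left, inner_neg_left] at this
      rw [this, hτSg]; ring
    have e5 : ⟪R, R⟫_ℝ * ⟪R, S (S R)⟫_ℝ = ⟪S R, R⟫_ℝ * ⟪S R, R⟫_ℝ := by
      rw [← hS, hSRSR]
    linear_combination ⟪R, R⟫_ℝ * h - ⟪R, R⟫_ℝ * e4 - e3 - e5
  -- the vector `T R R` resolved in the frame
  have hw3y : ⟪T R R, y⟫_ℝ = (l - 2) * ⟪S R, R⟫_ℝ := by rw [hT2, hTRyw]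
  have hw3τ : ⟪T R R, τ⟫_ℝ = ⟪y, y⟫_ℝ * ⟪T R g, R⟫_ℝ - l * Y0 * ((l - 2) * ⟪S R, R⟫_ℝ) := by
    rw [hT2, hτeq, map_sub, map_smul, map_smul, inner_sub_left, real_inner_smul_left, real_inner_smul_left, hTRyw]
  have hw3 : ∀ w, ⟪y, y⟫_ℝ * ⟪R, R⟫_ℝ * ⟪T R R, w⟫_ℝ =
      ⟪R, R⟫_ℝ * (l - 2) * ⟪S R, R⟫_ℝ * ⟪y, w⟫_ℝ
        + (⟪y, y⟫_ℝ * ⟪T R g, R⟫_ℝ - l * Y0 * (l - 2) * ⟪S R, R⟫_ℝ) * ⟪τ, w⟫_ℝ := fun w => by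
    have h := frame_resolution y g (T R R)
    rw [← hRdef, ← hτdef, hw3y, hw3τ, hTRRR, mul_zero, zero_smul, add_zero] at h
    have := congrArg (fun z => ⟪z, w⟫_ℝ) h
    simp only [real_inner_smul_left, inner_add_left] at this
    linarith [this]
  -- the derivative of `c` collapses to `−⟪T R R, v⟫/ρ`
  have hTv : ⟪T v R, R⟫_ℝ = ⟪T R R, v⟫_ℝ := by rw [hT1, hT2]
  have hdc' : dc * ⟪R, R⟫_ℝ = -⟪T R R, v⟫_ℝ := by
    set D := cross v g + cross y (S v) with hD
    have e1 : ⟪R, R⟫_ℝ * ⟪S D, R⟫_ℝ = ⟪S R, R⟫_ℝ * ⟪R, D⟫_ℝ := by rw [hS, real_inner_comm (S R) D, hSR D]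
    have e2 : ⟪R, R⟫_ℝ * ⟪S R, D⟫_ℝ = ⟪S R, R⟫_ℝ * ⟪R, D⟫_ℝ := hSR D
    have h := hdc
    rw [inner_add_left, hTv, real_inner_comm R D] at h
    have h' : dc * ⟪R, R⟫_ℝ * ⟪R, R⟫_ℝ = -⟪T R R, v⟫_ℝ * ⟪R, R⟫_ℝ := by
      linear_combination h - e1 - e2
    exact mul_right_cancel₀ hρ0 h'
  -- conclude in the frame
  apply cross_eq_zero_of_frame y g hR
  · -- `⟪A′v, R⟫ = 0`
    show ⟪S v + dc • y + c • v, R⟫_ℝ = 0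
    rw [inner_add_left, inner_add_left, real_inner_smul_left, real_inner_smul_left, hyR, mul_zero, add_zero]
    have e1 : ⟪R, R⟫_ℝ * ⟪S v, R⟫_ℝ = ⟪S R, R⟫_ℝ * ⟪v, R⟫_ℝ := by
      rw [hS, real_inner_comm (S R) v, hSR v, real_inner_comm v R]
    have key : ⟪R, R⟫_ℝ * (⟪S v, R⟫_ℝ + c * ⟪v, R⟫_ℝ) = 0 := by
      linear_combination e1 + ⟪v, R⟫_ℝ * hc
    exact (mul_eq_zero.mp key).resolve_left hρ0
  · -- `⟪A, R⟫ = 0`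
    show ⟪g + c • y, R⟫_ℝ = 0
    rw [inner_add_left, real_inner_smul_left, hgR, hyR, mul_zero, add_zero]
  · -- proportionality of the `(y, τ)` components = the scalar (Riccati) identity
    show ⟪S v + dc • y + c • v, y⟫_ℝ * ⟪g + c • y, τ⟫_ℝ = ⟪S v + dc • y + c • v, τ⟫_ℝ * ⟪g + c • y, y⟫_ℝ
    have eXy : ⟪S v + dc • y + c • v, y⟫_ℝ = (l - 1) * ⟪v, g⟫_ℝ + dc * ⟪y, y⟫_ℝ + c * ⟪y, v⟫_ℝ := by
      rw [inner_add_left, inner_add_left, real_inner_smul_left, real_inner_smul_left, hS, hE1, real_inner_smul_right,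
        real_inner_comm y v]
    have eXτ : ⟪S v + dc • y + c • v, τ⟫_ℝ = ⟪S τ, v⟫_ℝ + c * ⟪τ, v⟫_ℝ := by
      rw [inner_add_left, inner_add_left, real_inner_smul_left, real_inner_smul_left, hS, hyτ, mul_zero, add_zero,
        real_inner_comm (S τ) v, real_inner_comm τ v]
    have eZy : ⟪g + c • y, y⟫_ℝ = l * Y0 + c * ⟪y, y⟫_ℝ := by
      rw [inner_add_left, real_inner_smul_left, hgy]
    have eZτ : ⟪g + c • y, τ⟫_ℝ = ⟪R, R⟫_ℝ := by
      rw [inner_add_left, real_inner_smul_left, hgτ, hyτ, mul_zero, add_zero]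
    rw [eXy, eXτ, eZy, eZτ]
    have hvg : ⟪y, y⟫_ℝ * ⟪v, g⟫_ℝ = ⟪τ, v⟫_ℝ + l * Y0 * ⟪y, v⟫_ℝ := by
      have := congrArg (fun z => ⟪z, v⟫_ℝ) hgeq
      simp only [real_inner_smul_left, inner_add_left] at this
      rw [real_inner_comm g v]; linarith
    exact angular_scalar_identity l Y0 ⟪y, y⟫_ℝ ⟪R, R⟫_ℝ ⟪S R, R⟫_ℝ ⟪y, v⟫_ℝ ⟪τ, v⟫_ℝ ⟪S g, g⟫_ℝ ⟪g, g⟫_ℝ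
      ⟪T R g, R⟫_ℝ ⟪S τ, τ⟫_ℝ ⟪T R R, v⟫_ℝ ⟪S τ, v⟫_ℝ dc c ⟪v, g⟫_ℝ hr20 hρ0 hc hdc' (hw3 v) (hSτ v) hsττ
      ht1 hσ hGρ hvg

end Summit.NavierStokesRegularity.NavierStokesRegularity.Theorems.UnthreadedRigidity.VirialHorn
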